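import Summits.QuantumFields.YangMills.Theorems.BalabanUVNodesN15TwoSpacingGluingCurvedKnitObjects
import HarnessLib

/-!
# THE GLUING STEP AT TWO LATTICE SPACINGS — (Γ15b) THE LIVE-`U` KNIT AT THE COVER, TWO GRIDS, IV: THE FINE-GRID OBJECTS — the cover's cut `χ′_k`, plateau `ψ′_k`, radius-2 bump `χ̃′_k`,
# flat cubes `G′(□_k) ⊗ 1_ι`, flat nonlocal part `N′_L ⊗ 1_ι` and the GLUED OPERATOR `cvGlued'` at the FINE spacing `η′ = (L^rL^k)^{−1}` of the same doubled torus (dag-n15-c g15,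
# FILE 123a; N15 = NE2, s1 «background-layer OPERATOR ingredient»)

Cell `pub-ymgap`, seat `pub-ymgap-dag-n15-c` (R134 (a); HUMAN RULING D-0062), generation 15.  `bears_on: R4∕N15 · K3⁸ SpineGivenEndpointR13SepCoPHV (stmt-QuantumFields-27366)`.
Filed `--kind proof --supports stmt-QuantumFields-27366 --as helper` — COUNT-NEUTRAL.  Definitions only (reviewed lane); imports BY NAME FILE 119 `…CurvedKnitObjects` (`cvM`, `CvX`,
`cvChi`, `cvPsi`, `cvBump`, `cvCube`, `cvNL`, `cvGlued` — the COARSE spacing `L^{−k}`); nothing in the tree is modified.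

WHAT.  dag-n15-w3 file 53 `CurvedSpecies.uN_hasMaj_idef_glueInv_smoothCutDressed_localGauges` compares the glued propagator of Bałaban's `Δ_{R_U} + P` on TWO grids `X′ → X` through a
pairing `π`.  At the cover the two grids are the bond carriers of the doubled torus `M_ν = 2L·L^m` at spacings `η = L^{−k}` (FILE 119's objects) and `η′ = (L^rL^k)^{−1}` (THIS file), paired
by King's `kingPrV L k r M` (dag-n15-a); the fine objects are the SAME formulas at the fine spacing: `CvX'`, `cvChi'`, `cvPsi'`, `cvBump'` (FILE 66∕67 coordinates `coverXi M (L^rL^k) (L^m)`,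
dag-n15-w4 `bcube`, dag-n15-a `chiCube`), `cvCube'` (FILE 70 `knitG … (L^rL^k)`), `cvNL'`, and ★ `cvGlued'` = 53's fine glued operator VERBATIM with these objects (per-cube unitary gauges
`u′_k`, bond field `U′`, summand `P′`, perturbations `N′_V k`).  FILE 123 proves the η-defect bound `𝔇(cvGlued', cvGlued) ≤ D·((L^k)^{−1∕16} + o + o_W + r_D)·e^{−(δ∕16)d}`.

HONEST FRAMING ∕ LIMITS.  Definitions on MODEL carriers; no estimate here; nothing of [B5]∕[B6]∕[B9] asserted ((3.62)–(3.65) pp.402–403, (2.91) p.239: shapes).  NE2⁺ NOT PRINTED, NOT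
proved; N15 NOT discharged; K3⁸ OPEN, skeleton v6 untouched; counts of record UNMOVED (typed 28∕28 · discharged 5∕27); one finite 𝕋⁴ at fixed ε — NOT infinite volume, NOT OS on ℝ⁴,
NOT a mass gap, NOT Clay; R4 closes the conditional finite-𝕋⁴ rung `BalabanLadder.UV` only.
-/

noncomputable section

open scoped BigOperators Matrix Matrix.Norms.Frobenius

namespace Summit.QuantumFields.YangMills.BalabanUVNodes.N15.Gluing

open Literature.MathematicalPhysics.QuantumFieldTheory.Balaban1983to89
open Literature.MathematicalPhysics.QuantumFieldTheory.Balaban1983to89.B5Prop11Plancherel (Tor fine)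
open Literature.MathematicalPhysics.QuantumFieldTheory.Balaban1983to89.B6Prop26Gluing (mulOp)
open Summit.QuantumFields.YangMills.BalabanUVNodes.N15.BackgroundLayer (fgrad bgrad stack projO bgPropV covLapM tCoefA tCoefC unstackM)
open Summit.QuantumFields.YangMills.BalabanUVNodes.N15.VectorPiece (bshiftEquiv tensorId)
open Summit.QuantumFields.YangMills.BalabanUVNodes.N15.MatrixSpecies (mmulOp coordMat liftEquiv)
open Summit.QuantumFields.YangMills.BalabanUVNodes.N15.TwoGrid (landauRe qvRe qvAdjRe chiCube)
open Summit.QuantumFields.YangMills.BalabanUVNodes.N15.CurvedSpecies (gaugePair)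

variable (d : ℕ) (L : ℕ) [NeZero L]

/-! ## §1 The fine-grid objects of the live-`U` knit at the cover -/

/-- the bond carrier at the FINE spacing `(L^rL^k)^{−1}` on the doubled torus `2L·L^m` (dag-n15-a's fine lattice, paired to `CvX` by `kingPrV L k r`). [folklore] -/
abbrev CvX' (mv kk r : ℕ) (hL : Odd L ∧ 1 < L) : Type := Tor (fine (L ^ r * L ^ kk) (cvM d L mv kk hL)) × Fin (d + 1)

/-- THE FINE INPUT CUT `χ′_k`: the indicator of the blocks of the box `c(2w, k) + [0, 6w+1)^{d+1}` read on fine bonds. [cite: Balaban1985BackgroundPropagators, (3.62)–(3.65) pp.402–403 (shape)] -/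
abbrev cvChi' (mv kk r : ℕ) (hL : Odd L ∧ 1 < L) (k : Fin (d + 1) → ZMod (2 * L)) : CvX' d L mv kk r hL → ℝ :=
  chiCube (cvM d L mv kk hL) (L ^ r * L ^ kk) (coverCorner (cvM d L mv kk hL) (L ^ mv) L (2 * L ^ mv) k) (6 * L ^ mv + 1)

/-- THE FINE PLATEAU `ψ′_k`: the indicator of the blocks of the cube `□_k` read on fine bonds. [cite: Balaban1984PropagatorsII, (2.37) p.229 (shape)] -/
abbrev cvPsi' (mv kk r : ℕ) (hL : Odd L ∧ 1 < L) (k : Fin (d + 1) → ZMod (2 * L)) : CvX' d L mv kk r hL → ℝ :=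
  chiCube (cvM d L mv kk hL) (L ^ r * L ^ kk) (coverCorner (cvM d L mv kk hL) (L ^ mv) L (coverMargin L mv) k) (L * L ^ mv)

/-- THE FINE SMOOTH CUT `χ̃′_k`: dag-n15-w4's radius-2 bump on the cover's FINE coordinates. [cite: Balaban1985BackgroundPropagators, (3.62)–(3.65) pp.402–403 (shape)] -/
abbrev cvBump' (mv kk r : ℕ) (hL : Odd L ∧ 1 < L) (k : Fin (d + 1) → ZMod (2 * L)) : CvX' d L mv kk r hL → ℝ :=
  bcube (2 * L) (coverXi (cvM d L mv kk hL) (L ^ r * L ^ kk) (L ^ mv)) 2 k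

/-- THE FINE FLAT CUBE OPERATOR `N′_k = G′(□_k) ⊗ 1_ι` (FILE 70's Neumann cube of the cover at the fine spacing). [cite: Balaban1984PropagatorsII, (2.37) p.229, (2.156) p.250 (shape)] -/
def cvCube' (mv kk r : ℕ) (hL : Odd L ∧ 1 < L) (a : ℝ) (ι : Type) (k : Fin (d + 1) → ZMod (2 * L)) : (CvX' d L mv kk r hL × ι → ℝ) →ₗ[ℝ] (CvX' d L mv kk r hL × ι → ℝ) :=
  tensorId ι (knitG d L mv kk (L ^ r * L ^ kk) hL a k)

/-- THE FINE FLAT NONLOCAL PART `N′_L = (aQ′*Q′ − ∂′Π′∂′*) ⊗ 1_ι`. [cite: Balaban1984PropagatorsI, (1.69) p.29 (shape)] -/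
def cvNL' (mv kk r : ℕ) (hL : Odd L ∧ 1 < L) (a : ℝ) (ι : Type) : (CvX' d L mv kk r hL × ι → ℝ) →ₗ[ℝ] (CvX' d L mv kk r hL × ι → ℝ) :=
  tensorId ι (a • (qvAdjRe (cvM d L mv kk hL) (L ^ r * L ^ kk) ∘ₗ qvRe (cvM d L mv kk hL) (L ^ r * L ^ kk)) + (-landauRe (cvM d L mv kk hL) (L ^ r * L ^ kk)))

/-- ★ **THE GLUED OPERATOR OF THE LIVE-`U` KNIT AT THE FINE SPACING** — dag-n15-w3 53's fine glued operator `G′₀(1 − R′)⁻¹` VERBATIM with the cover's fine objects: partition `h′_k`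
(FILE 70 `knitH … (L^rL^k)`), cut `χ′_k`, plateau `ψ′_k`, bump `χ̃′_k`, flat cubes `N′_k`, flat nonlocal part `N′_L`, shifts `bshiftEquiv M (L^rL^k)`; per-cube unitary gauges `u′_k`,
the unitary bond field `U′`, Bałaban's summand `P′`, the nonlocal perturbations `N′_V k`, spacing `η′`. [cite: Balaban1985BackgroundPropagators, (3.62)–(3.65) pp.402–403, (3.76)–(3.77)
p.406 (mechanism); Balaban1984PropagatorsII, (2.91) p.239, (2.133)–(2.136) p.247] -/
def cvGlued' (mv kk r : ℕ) (hL : Odd L ∧ 1 < L) (a η : ℝ) (ι : Type) [Fintype ι] [DecidableEq ι] {mm : Type} [Fintype mm] [DecidableEq mm] (e : Matrix mm mm ℂ ≃L[ℝ] (ι → ℝ))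
    (u : (Fin (d + 1) → ZMod (2 * L)) → CvX' d L mv kk r hL → Matrix mm mm ℂ) (U : Fin (d + 1) → CvX' d L mv kk r hL → Matrix mm mm ℂ)
    (P : (CvX' d L mv kk r hL × ι → ℝ) →ₗ[ℝ] (CvX' d L mv kk r hL × ι → ℝ)) (NV : (Fin (d + 1) → ZMod (2 * L)) → (CvX' d L mv kk r hL × ι → ℝ) →ₗ[ℝ] (CvX' d L mv kk r hL × ι → ℝ)) :
    (CvX' d L mv kk r hL × ι → ℝ) →ₗ[ℝ] (CvX' d L mv kk r hL × ι → ℝ) :=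
  glueInv (parametrix (fun k (p : CvX' d L mv kk r hL × ι) => knitH d L mv kk (L ^ r * L ^ kk) hL k p.1) (fun k => mmulOp (fun x => (coordMat e (ContinuousLinearMap.mulLeftRight ℝ (Matrix mm mm ℂ) (u
  k x) (u k x)ᴴ))ᵀ) ∘ₗ (projO none ∘ₗ bgPropV (stack (mulOp (fun p : CvX' d L mv kk r hL × ι => cvBump' d L mv kk r hL k p.1) ∘ₗ (cvCube' d L mv kk r hL a ι k)) (fun j => Sum.elim (fun μ => fgrad η⁻¹
  (liftEquiv (bshiftEquiv (cvM d L mv kk hL) (L ^ r * L ^ kk) μ) ι)) (fun μ => bgrad η⁻¹ (liftEquiv (bshiftEquiv (cvM d L mv kk hL) (L ^ r * L ^ kk) μ) ι)) j ∘ₗ (mulOp (fun p : CvX' d L mv kk r hL × ι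
  => cvBump' d L mv kk r hL k p.1) ∘ₗ (cvCube' d L mv kk r hL a ι k)))) (mulOp (fun p : CvX' d L mv kk r hL × ι => cvPsi' d L mv kk r hL k p.1) ∘ₗ (unstackM (tCoefC η (gaugePair (bshiftEquiv (cvM d L
  mv kk hL) (L ^ r * L ^ kk)) fun μ x => coordMat e (ContinuousLinearMap.mulLeftRight ℝ (Matrix mm mm ℂ) (u k x * U μ x * (u k (bshiftEquiv (cvM d L mv kk hL) (L ^ r * L ^ kk) μ x))ᴴ) (u k x * U μ x *
  (u k (bshiftEquiv (cvM d L mv kk hL) (L ^ r * L ^ kk) μ x))ᴴ)ᴴ)))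
            (tCoefA η (gaugePair (bshiftEquiv (cvM d L mv kk hL) (L ^ r * L ^ kk)) fun μ x => coordMat e
  (ContinuousLinearMap.mulLeftRight ℝ (Matrix mm mm ℂ) (u k x * U μ x * (u k (bshiftEquiv (cvM d L mv kk hL) (L ^ r * L ^ kk) μ x))ᴴ) (u k x * U μ x * (u k (bshiftEquiv (cvM d L mv kk hL) (L ^ r * L ^
  kk) μ x))ᴴ)ᴴ))) + NV k ∘ₗ projO none) ∘ₗ mulOp (fun q : (CvX' d L mv kk r hL × ι) × Option (Fin (d + 1) ⊕ Fin (d + 1)) => cvChi' d L mv kk r hL k q.1.1))) ∘ₗ mmulOp (fun x => coordMat e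
  (ContinuousLinearMap.mulLeftRight ℝ (Matrix mm mm ℂ) (u k x) (u k x)ᴴ))))
          (remainder (covLapM (bshiftEquiv (cvM d L mv kk hL) (L ^ r * L ^ kk)) η (gaugePair (bshiftEquiv (cvM d L mv kk hL)
  (L ^ r * L ^ kk)) (fun μ x => coordMat e (ContinuousLinearMap.mulLeftRight ℝ (Matrix mm mm ℂ) (U μ x) (U μ x)ᴴ))) + P) (fun k (p : CvX' d L mv kk r hL × ι) => knitH d L mv kk (L ^ r * L ^ kk) hL k
  p.1) (fun k => mmulOp (fun x => (coordMat e (ContinuousLinearMap.mulLeftRight ℝ (Matrix mm mm ℂ) (u k x) (u k x)ᴴ))ᵀ) ∘ₗ (projO none ∘ₗ bgPropV (stack (mulOp (fun p : CvX' d L mv kk r hL × ι =>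
  cvBump' d L mv kk r hL k p.1) ∘ₗ (cvCube' d L mv kk r hL a ι k)) (fun j => Sum.elim (fun μ => fgrad η⁻¹ (liftEquiv (bshiftEquiv (cvM d L mv kk hL) (L ^ r * L ^ kk) μ) ι)) (fun μ => bgrad η⁻¹
  (liftEquiv (bshiftEquiv (cvM d L mv kk hL) (L ^ r * L ^ kk) μ) ι)) j ∘ₗ (mulOp (fun p : CvX' d L mv kk r hL × ι => cvBump' d L mv kk r hL k p.1) ∘ₗ (cvCube' d L mv kk r hL a ι k)))) (mulOp (fun p :
  CvX' d L mv kk r hL × ι => cvPsi' d L mv kk r hL k p.1) ∘ₗ (unstackM (tCoefC η (gaugePair (bshiftEquiv (cvM d L mv kk hL) (L ^ r * L ^ kk)) fun μ x => coordMat e (ContinuousLinearMap.mulLeftRight ℝ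
  (Matrix mm mm ℂ) (u k x * U μ x * (u k (bshiftEquiv (cvM d L mv kk hL) (L ^ r * L ^ kk) μ x))ᴴ) (u k x * U μ x * (u k (bshiftEquiv (cvM d L mv kk hL) (L ^ r * L ^ kk) μ x))ᴴ)ᴴ)))
            (tCoefA
  η (gaugePair (bshiftEquiv (cvM d L mv kk hL) (L ^ r * L ^ kk)) fun μ x => coordMat e (ContinuousLinearMap.mulLeftRight ℝ (Matrix mm mm ℂ) (u k x * U μ x * (u k (bshiftEquiv (cvM d L mv kk hL) (L ^ r
  * L ^ kk) μ x))ᴴ) (u k x * U μ x * (u k (bshiftEquiv (cvM d L mv kk hL) (L ^ r * L ^ kk) μ x))ᴴ)ᴴ))) + NV k ∘ₗ projO none) ∘ₗ mulOp (fun q : (CvX' d L mv kk r hL × ι) × Option (Fin (d + 1) ⊕ Fin (d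
  + 1)) => cvChi' d L mv kk r hL k q.1.1))) ∘ₗ mmulOp (fun x => coordMat e (ContinuousLinearMap.mulLeftRight ℝ (Matrix mm mm ℂ) (u k x) (u k x)ᴴ))) -
            ∑ k, (mmulOp (fun x => (coordMat e
  (ContinuousLinearMap.mulLeftRight ℝ (Matrix mm mm ℂ) (u k x) (u k x)ᴴ))ᵀ) ∘ₗ ((((-(mulOp (fun p : CvX' d L mv kk r hL × ι => knitH d L mv kk (L ^ r * L ^ kk) hL k p.1) ∘ₗ (cvNL' d L mv kk r hL a ι)
  ∘ₗ mulOp (1 - fun p : CvX' d L mv kk r hL × ι => cvBump' d L mv kk r hL k p.1))) ∘ₗ (cvCube' d L mv kk r hL a ι k)) ∘ₗ (LinearMap.id + ((mulOp (fun p : CvX' d L mv kk r hL × ι => cvPsi' d L mv kk r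
  hL k p.1) ∘ₗ (unstackM (tCoefC η (gaugePair (bshiftEquiv (cvM d L mv kk hL) (L ^ r * L ^ kk)) fun μ x => coordMat e (ContinuousLinearMap.mulLeftRight ℝ (Matrix mm mm ℂ) (u k x * U μ x * (u k
  (bshiftEquiv (cvM d L mv kk hL) (L ^ r * L ^ kk) μ x))ᴴ) (u k x * U μ x * (u k (bshiftEquiv (cvM d L mv kk hL) (L ^ r * L ^ kk) μ x))ᴴ)ᴴ)))
            (tCoefA η (gaugePair (bshiftEquiv (cvM d L mv
  kk hL) (L ^ r * L ^ kk)) fun μ x => coordMat e (ContinuousLinearMap.mulLeftRight ℝ (Matrix mm mm ℂ) (u k x * U μ x * (u k (bshiftEquiv (cvM d L mv kk hL) (L ^ r * L ^ kk) μ x))ᴴ) (u k x * U μ x * (u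
  k (bshiftEquiv (cvM d L mv kk hL) (L ^ r * L ^ kk) μ x))ᴴ)ᴴ))) + NV k ∘ₗ projO none) ∘ₗ mulOp (fun q : (CvX' d L mv kk r hL × ι) × Option (Fin (d + 1) ⊕ Fin (d + 1)) => cvChi' d L mv kk r hL k
  q.1.1)) ∘ₗ stack LinearMap.id (fun j => Sum.elim (fun μ => fgrad η⁻¹ (liftEquiv (bshiftEquiv (cvM d L mv kk hL) (L ^ r * L ^ kk) μ) ι)) (fun μ => bgrad η⁻¹ (liftEquiv (bshiftEquiv (cvM d L mv kk hL)
  (L ^ r * L ^ kk) μ) ι)) j)) ∘ₗ (projO none ∘ₗ bgPropV (stack (mulOp (fun p : CvX' d L mv kk r hL × ι => cvBump' d L mv kk r hL k p.1) ∘ₗ (cvCube' d L mv kk r hL a ι k)) (fun j => Sum.elim (fun μ =>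
  fgrad η⁻¹ (liftEquiv (bshiftEquiv (cvM d L mv kk hL) (L ^ r * L ^ kk) μ) ι)) (fun μ => bgrad η⁻¹ (liftEquiv (bshiftEquiv (cvM d L mv kk hL) (L ^ r * L ^ kk) μ) ι)) j ∘ₗ (mulOp (fun p : CvX' d L mv
  kk r hL × ι => cvBump' d L mv kk r hL k p.1) ∘ₗ (cvCube' d L mv kk r hL a ι k)))) (mulOp (fun p : CvX' d L mv kk r hL × ι => cvPsi' d L mv kk r hL k p.1) ∘ₗ (unstackM (tCoefC η (gaugePair
  (bshiftEquiv (cvM d L mv kk hL) (L ^ r * L ^ kk)) fun μ x => coordMat e (ContinuousLinearMap.mulLeftRight ℝ (Matrix mm mm ℂ) (u k x * U μ x * (u k (bshiftEquiv (cvM d L mv kk hL) (L ^ r * L ^ kk) μ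
  x))ᴴ) (u k x * U μ x * (u k (bshiftEquiv (cvM d L mv kk hL) (L ^ r * L ^ kk) μ x))ᴴ)ᴴ)))
            (tCoefA η (gaugePair (bshiftEquiv (cvM d L mv kk hL) (L ^ r * L ^ kk)) fun μ x => coordMat e
  (ContinuousLinearMap.mulLeftRight ℝ (Matrix mm mm ℂ) (u k x * U μ x * (u k (bshiftEquiv (cvM d L mv kk hL) (L ^ r * L ^ kk) μ x))ᴴ) (u k x * U μ x * (u k (bshiftEquiv (cvM d L mv kk hL) (L ^ r * L ^
  kk) μ x))ᴴ)ᴴ))) + NV k ∘ₗ projO none) ∘ₗ mulOp (fun q : (CvX' d L mv kk r hL × ι) × Option (Fin (d + 1) ⊕ Fin (d + 1)) => cvChi' d L mv kk r hL k q.1.1)))) + mulOp (fun p : CvX' d L mv kk r hL × ι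
  => knitH d L mv kk (L ^ r * L ^ kk) hL k p.1) ∘ₗ (-(((unstackM (tCoefC η (gaugePair (bshiftEquiv (cvM d L mv kk hL) (L ^ r * L ^ kk)) fun μ x => coordMat e (ContinuousLinearMap.mulLeftRight ℝ
  (Matrix mm mm ℂ) (u k x * U μ x * (u k (bshiftEquiv (cvM d L mv kk hL) (L ^ r * L ^ kk) μ x))ᴴ) (u k x * U μ x * (u k (bshiftEquiv (cvM d L mv kk hL) (L ^ r * L ^ kk) μ x))ᴴ)ᴴ)))
            (tCoefA
  η (gaugePair (bshiftEquiv (cvM d L mv kk hL) (L ^ r * L ^ kk)) fun μ x => coordMat e (ContinuousLinearMap.mulLeftRight ℝ (Matrix mm mm ℂ) (u k x * U μ x * (u k (bshiftEquiv (cvM d L mv kk hL) (L ^ r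
  * L ^ kk) μ x))ᴴ) (u k x * U μ x * (u k (bshiftEquiv (cvM d L mv kk hL) (L ^ r * L ^ kk) μ x))ᴴ)ᴴ))) + NV k ∘ₗ projO none) - mulOp (fun p : CvX' d L mv kk r hL × ι => cvPsi' d L mv kk r hL k p.1) ∘ₗ
  (unstackM (tCoefC η (gaugePair (bshiftEquiv (cvM d L mv kk hL) (L ^ r * L ^ kk)) fun μ x => coordMat e (ContinuousLinearMap.mulLeftRight ℝ (Matrix mm mm ℂ) (u k x * U μ x * (u k (bshiftEquiv (cvM d
  L mv kk hL) (L ^ r * L ^ kk) μ x))ᴴ) (u k x * U μ x * (u k (bshiftEquiv (cvM d L mv kk hL) (L ^ r * L ^ kk) μ x))ᴴ)ᴴ)))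
            (tCoefA η (gaugePair (bshiftEquiv (cvM d L mv kk hL) (L ^ r * L ^
  kk)) fun μ x => coordMat e (ContinuousLinearMap.mulLeftRight ℝ (Matrix mm mm ℂ) (u k x * U μ x * (u k (bshiftEquiv (cvM d L mv kk hL) (L ^ r * L ^ kk) μ x))ᴴ) (u k x * U μ x * (u k (bshiftEquiv (cvM
  d L mv kk hL) (L ^ r * L ^ kk) μ x))ᴴ)ᴴ))) + NV k ∘ₗ projO none) ∘ₗ mulOp (fun q : (CvX' d L mv kk r hL × ι) × Option (Fin (d + 1) ⊕ Fin (d + 1)) => cvChi' d L mv kk r hL k q.1.1)) ∘ₗ stack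
  LinearMap.id (fun j => Sum.elim (fun μ => fgrad η⁻¹ (liftEquiv (bshiftEquiv (cvM d L mv kk hL) (L ^ r * L ^ kk) μ) ι)) (fun μ => bgrad η⁻¹ (liftEquiv (bshiftEquiv (cvM d L mv kk hL) (L ^ r * L ^ kk)
  μ) ι)) j))) ∘ₗ (projO none ∘ₗ bgPropV (stack (mulOp (fun p : CvX' d L mv kk r hL × ι => cvBump' d L mv kk r hL k p.1) ∘ₗ (cvCube' d L mv kk r hL a ι k)) (fun j => Sum.elim (fun μ => fgrad η⁻¹
  (liftEquiv (bshiftEquiv (cvM d L mv kk hL) (L ^ r * L ^ kk) μ) ι)) (fun μ => bgrad η⁻¹ (liftEquiv (bshiftEquiv (cvM d L mv kk hL) (L ^ r * L ^ kk) μ) ι)) j ∘ₗ (mulOp (fun p : CvX' d L mv kk r hL × ι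
  => cvBump' d L mv kk r hL k p.1) ∘ₗ (cvCube' d L mv kk r hL a ι k)))) (mulOp (fun p : CvX' d L mv kk r hL × ι => cvPsi' d L mv kk r hL k p.1) ∘ₗ (unstackM (tCoefC η (gaugePair (bshiftEquiv (cvM d L
  mv kk hL) (L ^ r * L ^ kk)) fun μ x => coordMat e (ContinuousLinearMap.mulLeftRight ℝ (Matrix mm mm ℂ) (u k x * U μ x * (u k (bshiftEquiv (cvM d L mv kk hL) (L ^ r * L ^ kk) μ x))ᴴ) (u k x * U μ x *
  (u k (bshiftEquiv (cvM d L mv kk hL) (L ^ r * L ^ kk) μ x))ᴴ)ᴴ)))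
            (tCoefA η (gaugePair (bshiftEquiv (cvM d L mv kk hL) (L ^ r * L ^ kk)) fun μ x => coordMat e
  (ContinuousLinearMap.mulLeftRight ℝ (Matrix mm mm ℂ) (u k x * U μ x * (u k (bshiftEquiv (cvM d L mv kk hL) (L ^ r * L ^ kk) μ x))ᴴ) (u k x * U μ x * (u k (bshiftEquiv (cvM d L mv kk hL) (L ^ r * L ^
  kk) μ x))ᴴ)ᴴ))) + NV k ∘ₗ projO none) ∘ₗ mulOp (fun q : (CvX' d L mv kk r hL × ι) × Option (Fin (d + 1) ⊕ Fin (d + 1)) => cvChi' d L mv kk r hL k q.1.1))))) ∘ₗ mmulOp (fun x => coordMat e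
  (ContinuousLinearMap.mulLeftRight ℝ (Matrix mm mm ℂ) (u k x) (u k x)ᴴ))) ∘ₗ mulOp (fun p : CvX' d L mv kk r hL × ι => knitH d L mv kk (L ^ r * L ^ kk) hL k p.1))

end Summit.QuantumFields.YangMills.BalabanUVNodes.N15.Gluing

end
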